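import Summits.AtomisticToContinuum.HydrodynamicLimit.Theorems.AntiMazurCoboundariesKineticWindowGronwallThermalScalingFlow
import Summits.AtomisticToContinuum.HydrodynamicLimit.Theorems.AntiMazurCoboundariesKineticWindowGronwallThermalScalingGibbs
import HarnessLib

/-!
# The thermal frame of the kinetic window functional (helper, layer 4: the dictionary at `u₀ = 0`)

Crux `Summit.AtomisticToContinuum.HydrodynamicLimit.Theses.AntiMazurCoboundaries.KineticWindowGronwall`
(stmt-AtomisticToContinuum-9282, `= KineticFluxLdDecay → RelEntropyVanishing`), line `dlr-block-transfer` v6,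
registered stub `stub_thermalFrame : KineticThermalFrame` toward the lead's stub `stub_frameCovariance` (the constants
of the kinetic LD input are universal in the frame `(a, θ, u₀)`). This file is the exact THERMAL half at zero drift.

The antecedent of the crux bounds the exponential moment of the kinetic window functional
`h⁻¹ ∫₀ʰ Σᵢ φ(xᵢ(s)) g((vᵢ(s) − u₀)/√θ) ds`, `h = τ (N+1)^{-1/3}`, under the homogeneous local Gibbs law
`G_N(a, u₀, θ)`. The time–velocity rescaling `v ↦ v/√θ`, `t ↦ √θ t` is a symmetry of hard-sphere dynamics: layers 1–3
(`…KineticWindowGronwallThermalScalingTrajectory/Flow/Gibbs`) provide the rescaled flow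
`thermalScale Φ c _` (`Φ^{(c)}_t = scaleVel c ∘ Φ_{ct} ∘ scaleVel c⁻¹`), the identity
`(scaleVel (√θ)⁻¹)_# G_N(a, 0, θ) = G_N(a, 0, 1)` and the window dictionary `lintegral_window_thermal`. Putting them
together at `c = (√θ)⁻¹`: the functional at temperature `θ` and window `τ` under `G_N(a, 0, θ)` for `Φ` is LITERALLY the
functional at temperature `1` and window `√θ τ` under `G_N(a, 0, 1)` for `thermalScale Φ (√θ)⁻¹ _`
(`KineticThermalFrame`, `stub_thermalFrame`); general-observable form `lintegral_exp_window_thermalScale`; corollaries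
`kineticWindow_thermal_le_iff` (bounds transfer verbatim) and `kineticWindow_thermal_drift(_le_iff)` (the literal shape
of `KineticFluxLdDecay`/`KineticFluxLdDecayQ` at `u₀ = 0`, temperatures `θ` resp. `1`).
-/

noncomputable section

open Set Function MeasureTheory ProbabilityTheory
open scoped ENNReal
open Literature.Analysis.FluidPDE Literature.MathematicalPhysics.KineticTheory

namespace Summit.AtomisticToContinuum.HydrodynamicLimit.Theorems.KineticWindowGronwallThermalScaling

/-! ### Scalar bookkeeping -/

/-- `(r x)⁻¹ (r y) = x⁻¹ y` for `r ≠ 0` (the time-average prefactor absorbs the dilation factor). [folklore] -/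
theorem mul_inv_mul_mul_cancel {r : ℝ} (hr : r ≠ 0) (x y : ℝ) : (r * x)⁻¹ * (r * y) = x⁻¹ * y := by
  rw [mul_inv, mul_mul_mul_comm, inv_mul_cancel₀ hr, one_mul]

/-! ### The dictionary for exponential window moments -/

/-- **Exponential window moments in the thermal frame** (general observable `ψ`, any window length `h`, every
activity `a`, `θ > 0`): with `Ψ := thermalScale Φ (√θ)⁻¹ _` the thermally rescaled flow,
`∫⁻ exp (h⁻¹ ∫₀ʰ ψ (scaleVel (√θ)⁻¹ (Φ_s z)) ds) dG_N(a, 0, θ) = ∫⁻ exp ((√θ h)⁻¹ ∫₀^{√θ h} ψ (Ψ_s z) ds) dG_N(a, 0, 1)`: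
the statics `(scaleVel (√θ)⁻¹)_# G_N(a, 0, θ) = G_N(a, 0, 1)` and the kinematics `Ψ_s ∘ scaleVel (√θ)⁻¹ =
scaleVel (√θ)⁻¹ ∘ Φ_{s/√θ}` (`lintegral_window_thermal`), the Jacobian `√θ` of `s ↦ s/√θ` being absorbed by the
time average. [folklore] -/
theorem lintegral_exp_window_thermalScale (σ a : ℝ) {θ : ℝ} (hθ : 0 < θ) (N : ℕ)
    (Φ : HardSphereFlow (Torus.geometry (Fin 3)) (hsDiameter σ N) (N + 1))
    (ψ : Config (N + 1) (Fin 3) T3 → ℝ) (h : ℝ) :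
    ∫⁻ z, ENNReal.ofReal (Real.exp (h⁻¹ * ∫ s in (0 : ℝ)..h, ψ (scaleVel (Real.sqrt θ)⁻¹ (Φ.flow s z))))
        ∂(localGibbsLaw σ (fun _ => a) (fun _ => (0 : V3)) (fun _ => θ) N Φ) =
      ∫⁻ z, ENNReal.ofReal (Real.exp ((Real.sqrt θ * h)⁻¹ * ∫ s in (0 : ℝ)..(Real.sqrt θ * h),
            ψ ((thermalScale Φ (Real.sqrt θ)⁻¹ (inv_pos.2 (Real.sqrt_pos.2 hθ))).flow s z)))
        ∂(localGibbsLaw σ (fun _ => a) (fun _ => (0 : V3)) (fun _ => (1 : ℝ)) N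
            (thermalScale Φ (Real.sqrt θ)⁻¹ (inv_pos.2 (Real.sqrt_pos.2 hθ)))) := by
  have hs : Real.sqrt θ ≠ 0 := (Real.sqrt_pos.2 hθ).ne'
  rw [lintegral_window_thermal σ a hθ N Φ (thermalScale Φ (Real.sqrt θ)⁻¹ (inv_pos.2 (Real.sqrt_pos.2 hθ)))
    (fun _ _ => rfl) (fun y => ENNReal.ofReal (Real.exp ((Real.sqrt θ * h)⁻¹ * y))) ψ 0 (Real.sqrt θ * h)]
  refine lintegral_congr fun z => ?_
  rw [inv_inv, mul_zero, inv_mul_cancel_left₀ hs, mul_inv_mul_mul_cancel hs]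

/-! ### The registered statement -/

/-- THE THERMAL DICTIONARY FOR THE KINETIC WINDOW FUNCTIONAL: temperature `θ` at window `τ` is temperature `1` at window `√θ·τ` for the thermally rescaled flow. -/
def KineticThermalFrame : Prop :=
  ∀ (σ a θ : ℝ) (hθ : 0 < θ) (N : ℕ) (Φ : HardSphereFlow (Torus.geometry (Fin 3)) (hsDiameter σ N) (N + 1))
    (φ : T3 → ℝ) (g : V3 → ℝ) (τ : ℝ),
    ∫⁻ z, ENNReal.ofReal (Real.exp ((τ * ((N + 1 : ℕ) : ℝ) ^ (-(1 / 3 : ℝ)))⁻¹ *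
          ∫ s in (0 : ℝ)..(τ * ((N + 1 : ℕ) : ℝ) ^ (-(1 / 3 : ℝ))),
            ∑ i, φ (Φ.flow s z i).1 * g ((Real.sqrt θ)⁻¹ • (Φ.flow s z i).2)))
        ∂(localGibbsLaw σ (fun _ => a) (fun _ => (0 : V3)) (fun _ => θ) N Φ) =
    ∫⁻ z, ENNReal.ofReal (Real.exp (((Real.sqrt θ * τ) * ((N + 1 : ℕ) : ℝ) ^ (-(1 / 3 : ℝ)))⁻¹ *
          ∫ s in (0 : ℝ)..((Real.sqrt θ * τ) * ((N + 1 : ℕ) : ℝ) ^ (-(1 / 3 : ℝ))),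
            ∑ i, φ ((thermalScale Φ (Real.sqrt θ)⁻¹ (inv_pos.2 (Real.sqrt_pos.2 hθ))).flow s z i).1 *
              g ((thermalScale Φ (Real.sqrt θ)⁻¹ (inv_pos.2 (Real.sqrt_pos.2 hθ))).flow s z i).2))
        ∂(localGibbsLaw σ (fun _ => a) (fun _ => (0 : V3)) (fun _ => (1 : ℝ)) N
            (thermalScale Φ (Real.sqrt θ)⁻¹ (inv_pos.2 (Real.sqrt_pos.2 hθ))))

/-- **Layer 4, proved**: `stub_thermalFrame` — the kinetic window functional at temperature `θ`, window `τ`, law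
`G_N(a, 0, θ)` and flow `Φ` equals the one at temperature `1`, window `√θ τ`, law `G_N(a, 0, 1)` and flow
`thermalScale Φ (√θ)⁻¹ _` (`lintegral_exp_window_thermalScale` with `ψ w = Σᵢ φ (wᵢ.1) g (wᵢ.2)`, `h = τ (N+1)^{-1/3}`).
[folklore] -/
theorem stub_thermalFrame : KineticThermalFrame := by
  intro σ a θ hθ N Φ φ g τ
  have key := lintegral_exp_window_thermalScale σ a hθ N Φ (fun w => ∑ i, φ (w i).1 * g (w i).2)
    (τ * ((N + 1 : ℕ) : ℝ) ^ (-(1 / 3 : ℝ)))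
  rw [← mul_assoc (Real.sqrt θ) τ] at key
  simpa only [scaleVel_apply] using key

/-! ### Corollaries consumed by the block transfer -/

/-- **Bounds transfer verbatim.** For every bound `B : ℝ≥0∞`, the exponential moment of the kinetic window functional
at temperature `θ`, window `τ` (law `G_N(a, 0, θ)`, flow `Φ`) is `≤ B` iff the one at temperature `1`, window `√θ τ`
(law `G_N(a, 0, 1)`, flow `thermalScale Φ (√θ)⁻¹ _`) is `≤ B`. [folklore] -/
theorem kineticWindow_thermal_le_iff (σ a : ℝ) {θ : ℝ} (hθ : 0 < θ) (N : ℕ)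
    (Φ : HardSphereFlow (Torus.geometry (Fin 3)) (hsDiameter σ N) (N + 1)) (φ : T3 → ℝ) (g : V3 → ℝ) (τ : ℝ)
    (B : ℝ≥0∞) :
    ∫⁻ z, ENNReal.ofReal (Real.exp ((τ * ((N + 1 : ℕ) : ℝ) ^ (-(1 / 3 : ℝ)))⁻¹ *
          ∫ s in (0 : ℝ)..(τ * ((N + 1 : ℕ) : ℝ) ^ (-(1 / 3 : ℝ))),
            ∑ i, φ (Φ.flow s z i).1 * g ((Real.sqrt θ)⁻¹ • (Φ.flow s z i).2)))
        ∂(localGibbsLaw σ (fun _ => a) (fun _ => (0 : V3)) (fun _ => θ) N Φ) ≤ B ↔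
    ∫⁻ z, ENNReal.ofReal (Real.exp (((Real.sqrt θ * τ) * ((N + 1 : ℕ) : ℝ) ^ (-(1 / 3 : ℝ)))⁻¹ *
          ∫ s in (0 : ℝ)..((Real.sqrt θ * τ) * ((N + 1 : ℕ) : ℝ) ^ (-(1 / 3 : ℝ))),
            ∑ i, φ ((thermalScale Φ (Real.sqrt θ)⁻¹ (inv_pos.2 (Real.sqrt_pos.2 hθ))).flow s z i).1 *
              g ((thermalScale Φ (Real.sqrt θ)⁻¹ (inv_pos.2 (Real.sqrt_pos.2 hθ))).flow s z i).2))
        ∂(localGibbsLaw σ (fun _ => a) (fun _ => (0 : V3)) (fun _ => (1 : ℝ)) N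
            (thermalScale Φ (Real.sqrt θ)⁻¹ (inv_pos.2 (Real.sqrt_pos.2 hθ)))) ≤ B := by
  rw [stub_thermalFrame σ a θ hθ N Φ φ g τ]

/-- **The dictionary in the literal shape of the kinetic LD input** (`KineticFluxLdDecay`/`KineticFluxLdDecayQ` at
drift `u₀ = 0`, activity `a`): the integrand `g ((√θ)⁻¹ • (vᵢ − 0))` at temperature `θ` for `Φ`, window `τ`, versus
`g ((√1)⁻¹ • (vᵢ − 0))` at temperature `1` for `thermalScale Φ (√θ)⁻¹ _`, window `√θ τ`. [folklore] -/
theorem kineticWindow_thermal_drift (σ a : ℝ) {θ : ℝ} (hθ : 0 < θ) (N : ℕ)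
    (Φ : HardSphereFlow (Torus.geometry (Fin 3)) (hsDiameter σ N) (N + 1)) (φ : T3 → ℝ) (g : V3 → ℝ) (τ : ℝ) :
    ∫⁻ z, ENNReal.ofReal (Real.exp ((τ * ((N + 1 : ℕ) : ℝ) ^ (-(1 / 3 : ℝ)))⁻¹ *
          ∫ s in (0 : ℝ)..(τ * ((N + 1 : ℕ) : ℝ) ^ (-(1 / 3 : ℝ))),
            ∑ i, φ (Φ.flow s z i).1 * g ((Real.sqrt θ)⁻¹ • ((Φ.flow s z i).2 - 0))))
        ∂(localGibbsLaw σ (fun _ => a) (fun _ => (0 : V3)) (fun _ => θ) N Φ) =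
    ∫⁻ z, ENNReal.ofReal (Real.exp (((Real.sqrt θ * τ) * ((N + 1 : ℕ) : ℝ) ^ (-(1 / 3 : ℝ)))⁻¹ *
          ∫ s in (0 : ℝ)..((Real.sqrt θ * τ) * ((N + 1 : ℕ) : ℝ) ^ (-(1 / 3 : ℝ))),
            ∑ i, φ ((thermalScale Φ (Real.sqrt θ)⁻¹ (inv_pos.2 (Real.sqrt_pos.2 hθ))).flow s z i).1 *
              g ((Real.sqrt 1)⁻¹ •
                (((thermalScale Φ (Real.sqrt θ)⁻¹ (inv_pos.2 (Real.sqrt_pos.2 hθ))).flow s z i).2 - 0))))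
        ∂(localGibbsLaw σ (fun _ => a) (fun _ => (0 : V3)) (fun _ => (1 : ℝ)) N
            (thermalScale Φ (Real.sqrt θ)⁻¹ (inv_pos.2 (Real.sqrt_pos.2 hθ)))) := by
  simp only [sub_zero, Real.sqrt_one, inv_one, one_smul]
  exact stub_thermalFrame σ a θ hθ N Φ φ g τ

/-- **Bounds transfer in the literal shape of the kinetic LD input** (`u₀ = 0`): for every `B : ℝ≥0∞`, the drift-form
exponential moment at temperature `θ`, window `τ` for `Φ` is `≤ B` iff the drift-form exponential moment at temperature
`1`, window `√θ τ` for `thermalScale Φ (√θ)⁻¹ _` is `≤ B`. [folklore] -/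
theorem kineticWindow_thermal_drift_le_iff (σ a : ℝ) {θ : ℝ} (hθ : 0 < θ) (N : ℕ)
    (Φ : HardSphereFlow (Torus.geometry (Fin 3)) (hsDiameter σ N) (N + 1)) (φ : T3 → ℝ) (g : V3 → ℝ) (τ : ℝ)
    (B : ℝ≥0∞) :
    ∫⁻ z, ENNReal.ofReal (Real.exp ((τ * ((N + 1 : ℕ) : ℝ) ^ (-(1 / 3 : ℝ)))⁻¹ *
          ∫ s in (0 : ℝ)..(τ * ((N + 1 : ℕ) : ℝ) ^ (-(1 / 3 : ℝ))),
            ∑ i, φ (Φ.flow s z i).1 * g ((Real.sqrt θ)⁻¹ • ((Φ.flow s z i).2 - 0))))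
        ∂(localGibbsLaw σ (fun _ => a) (fun _ => (0 : V3)) (fun _ => θ) N Φ) ≤ B ↔
    ∫⁻ z, ENNReal.ofReal (Real.exp (((Real.sqrt θ * τ) * ((N + 1 : ℕ) : ℝ) ^ (-(1 / 3 : ℝ)))⁻¹ *
          ∫ s in (0 : ℝ)..((Real.sqrt θ * τ) * ((N + 1 : ℕ) : ℝ) ^ (-(1 / 3 : ℝ))),
            ∑ i, φ ((thermalScale Φ (Real.sqrt θ)⁻¹ (inv_pos.2 (Real.sqrt_pos.2 hθ))).flow s z i).1 *
              g ((Real.sqrt 1)⁻¹ •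
                (((thermalScale Φ (Real.sqrt θ)⁻¹ (inv_pos.2 (Real.sqrt_pos.2 hθ))).flow s z i).2 - 0))))
        ∂(localGibbsLaw σ (fun _ => a) (fun _ => (0 : V3)) (fun _ => (1 : ℝ)) N
            (thermalScale Φ (Real.sqrt θ)⁻¹ (inv_pos.2 (Real.sqrt_pos.2 hθ)))) ≤ B := by
  rw [kineticWindow_thermal_drift σ a hθ N Φ φ g τ]

end Summit.AtomisticToContinuum.HydrodynamicLimit.Theorems.KineticWindowGronwallThermalScaling

end
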